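import Mathlib
import Summits.Ventures.PercRepro2.TypedResidual

/-!
# The split of the residual class: separated and connected roots (blind cell PercRepro2, p2 g0,
2026-08-25; sub-claim S1, `proofs/subclaims/S1-REDUCTION.md`; the lead's alignment ask, INBOX
2026-08-25T00:56:57Z)

On a residual instance every edge off `F` is pinned closed, so «`a₁ ↔ a₂` in `z ∪ F`» reads
«`a₁ ↔ a₂` in the typed graph `(V, F)`», i.e. `Conn ends (typedConfig F) a₁ a₂` with
`typedConfig F` the configuration whose open edges are exactly the typed ones.

* **`ResidualSep`** — `Residual` with `a₁`, `a₂` in different components of `(V, F)`: the part of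
  `NR` inside the separated class of sub-claim S2;
* **`ResidualCon`** — `Residual` with `a₁ ↔ a₂` in `(V, F)`: the domain of sub-claim S4;
* `residual_sep_or_con` — `NR = ResidualSep ⊔ ResidualCon` (disjointly);
* **`typedCount_nonneg_of_sep_con`**, **`HCov_all_of_sep_con`** — the spine of S1 split along the
  two parts: (TRI) on `ResidualSep` and on `ResidualCon` give (TRI) everywhere and the crux of
  record `HCov_all`.

Own code; standard axioms.
-/

namespace Summit.Ventures.PercRepro2

open UnionCluster

namespace CovForm

namespace TypedRed

section Split

variable {V : Type*} {E : Type*} [DecidableEq V] [Fintype E] [DecidableEq E]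

/-- The configuration whose open edges are exactly the typed edges. -/
def typedConfig (F : Finset E) : Config E := fun e => decide (e ∈ F)

/-- **The separated part of `NR`**: `a₁` and `a₂` lie in different components of the typed graph
`(V, F)` (sub-claim S2's class, restricted to `NR`). -/
structure ResidualSep (ends : E → Sym2 V) (o a₁ a₂ a₃ b : V) (F : Finset E) : Prop where
  residual : Residual ends o a₁ a₂ a₃ b F
  sep : ¬ Conn ends (typedConfig F) a₁ a₂

/-- **The connected part of `NR`**: `a₁ ↔ a₂` in the typed graph `(V, F)` (the domain of sub-claim
S4). -/
structure ResidualCon (ends : E → Sym2 V) (o a₁ a₂ a₃ b : V) (F : Finset E) : Prop where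
  residual : Residual ends o a₁ a₂ a₃ b F
  con : Conn ends (typedConfig F) a₁ a₂

omit [DecidableEq V] [Fintype E] in
/-- `NR` is the disjoint union of its separated and connected parts. -/
theorem residual_sep_or_con {ends : E → Sym2 V} {o a₁ a₂ a₃ b : V} {F : Finset E}
    (h : Residual ends o a₁ a₂ a₃ b F) :
    ResidualSep ends o a₁ a₂ a₃ b F ∨ ResidualCon ends o a₁ a₂ a₃ b F := by
  by_cases hc : Conn ends (typedConfig F) a₁ a₂
  · exact Or.inr ⟨h, hc⟩
  · exact Or.inl ⟨h, hc⟩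

omit [DecidableEq V] [Fintype E] in
/-- The two parts are disjoint. -/
theorem not_residualSep_and_con {ends : E → Sym2 V} {o a₁ a₂ a₃ b : V} {F : Finset E}
    (hs : ResidualSep ends o a₁ a₂ a₃ b F) (hc : ResidualCon ends o a₁ a₂ a₃ b F) : False :=
  hs.sep hc.con

variable {R : Type*} [Field R] [LinearOrder R] [IsStrictOrderedRing R]

/-- **The spine, split**: (TRI) on the separated part and on the connected part of `NR` give (TRI)
on every instance. -/
theorem typedCount_nonneg_of_sep_con
    (hsep : ∀ (ends : E → Sym2 V) (o a₁ a₂ a₃ b : V) (F : Finset E) (τ : E → ℕ),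
      (∀ e ∈ F, τ e = 1 ∨ τ e = 2) → ResidualSep ends o a₁ a₂ a₃ b F →
        0 ≤ typedCount F (fun _ => false) τ
          (K3 ends o a₁ a₂ a₃ b : Config E → Config E → Config E → R))
    (hcon : ∀ (ends : E → Sym2 V) (o a₁ a₂ a₃ b : V) (F : Finset E) (τ : E → ℕ),
      (∀ e ∈ F, τ e = 1 ∨ τ e = 2) → ResidualCon ends o a₁ a₂ a₃ b F →
        0 ≤ typedCount F (fun _ => false) τ
          (K3 ends o a₁ a₂ a₃ b : Config E → Config E → Config E → R))
    (ends : E → Sym2 V) (o a₁ a₂ a₃ b : V) (F : Finset E) (z : Config E) (τ : E → ℕ)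
    (hτ : ∀ e ∈ F, τ e = 1 ∨ τ e = 2) :
    0 ≤ typedCount F z τ (K3 ends o a₁ a₂ a₃ b : Config E → Config E → Config E → R) := by
  refine typedCount_nonneg_of_residual (fun ends o a₁ a₂ a₃ b F τ hτ hres => ?_) ends o a₁ a₂ a₃ b
    F z τ hτ
  rcases residual_sep_or_con hres with hs | hc
  · exact hsep ends o a₁ a₂ a₃ b F τ hτ hs
  · exact hcon ends o a₁ a₂ a₃ b F τ hτ hc

end Split

section Closure

variable (R : Type*) [Field R] [LinearOrder R] [IsStrictOrderedRing R]

/-- **Row 2′TRI on the separated part of `NR`, over every finite graph** (a corollary of the full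
separated-class theorem of sub-claim S2). -/
def ResidualSep_all : Prop :=
  ∀ (V E : Type) [Fintype V] [DecidableEq V] [Fintype E] [DecidableEq E]
    (ends : E → Sym2 V) (o a₁ a₂ a₃ b : V) (F : Finset E) (τ : E → ℕ),
    (∀ e ∈ F, τ e = 1 ∨ τ e = 2) → ResidualSep ends o a₁ a₂ a₃ b F →
      0 ≤ typedCount F (fun _ => false) τ
        (K3 ends o a₁ a₂ a₃ b : Config E → Config E → Config E → R)

/-- **Row 2′TRI on the connected part of `NR`, over every finite graph** (the domain of sub-claim
S4). -/
def ResidualCon_all : Prop :=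
  ∀ (V E : Type) [Fintype V] [DecidableEq V] [Fintype E] [DecidableEq E]
    (ends : E → Sym2 V) (o a₁ a₂ a₃ b : V) (F : Finset E) (τ : E → ℕ),
    (∀ e ∈ F, τ e = 1 ∨ τ e = 2) → ResidualCon ends o a₁ a₂ a₃ b F →
      0 ≤ typedCount F (fun _ => false) τ
        (K3 ends o a₁ a₂ a₃ b : Config E → Config E → Config E → R)

omit [IsStrictOrderedRing R] in
/-- (TRI) on both parts of `NR` is (TRI) on `NR`. -/
theorem residual_all_of_sep_con (hs : ResidualSep_all R) (hc : ResidualCon_all R) :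
    Residual_all R := by
  intro V E _ _ _ _ ends o a₁ a₂ a₃ b F τ hτ hres
  rcases residual_sep_or_con hres with h | h
  · exact hs V E ends o a₁ a₂ a₃ b F τ hτ h
  · exact hc V E ends o a₁ a₂ a₃ b F τ hτ h

/-- **The crux of record from the two parts of `NR`**: `HCov_all` follows from (TRI) on the
separated residual instances (S2) and on the connected residual instances (S4). -/
theorem HCov_all_of_sep_con (hs : ResidualSep_all R) (hc : ResidualCon_all R) : HCov_all R :=
  HCov_all_of_residual_all R (residual_all_of_sep_con R hs hc)

end Closure

end TypedRed

end CovForm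

end Summit.Ventures.PercRepro2
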